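import Literature.NumberTheory.Automorphic.UnitaryGroupDoubledSiegelSquares
import HarnessLib

/-!
# The Siegel parabolic `P_Δ` of the doubled unitary group modulo products of squares: Levi representatives

Topic `NumberTheory/Automorphic`; namespace `Literature.NumberTheory.Automorphic.DoubledUnitary` (sequel of
`UnitaryGroupDoubledSiegelSquares`).  KERNEL only: proved theorems, no definition, no named fact, no `sorry`.

Setting ([Kudla1994, §3]; [HarrisKudlaSweet1996, §1 (1.9)–(1.12)]): `R` a commutative ring with an involution `σ` and
`2 ∈ Rˣ`; `S ∈ M_ι(R)` symmetric, `σ`-fixed, of unit determinant; the doubled unitary group `U(σ, S ⊕ −S)` and its Siegel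
parabolic `P_Δ = {p ∣ p₁₁ + p₁₂ = p₂₁ + p₂₂}`.  `UnitaryGroupDoubledSiegelSquares` proves: if `GL_ι(R)` is generated by squares,
every `p ∈ P_Δ` is a product of squares of elements of `P_Δ`.  When `GL_ι(R)` is NOT generated by squares (e.g. `R = ℝ`, or
`R = E ⊗ ℝ` for a number field `E` with a real place: `⟨g²⟩ = GL_ι⁺`, `Literature/LinearAlgebra/Matrix/GeneralLinearGroupSquaresReal`)
the same Cayley-basis argument gives the present REPRESENTATIVE form:

* **`exists_list_sq_mul_levi_of_isSiegel_blocks`** — if every `A ∈ GL_ι(R)` is `u · r` with `u ∈ ⟨squares of GL_ι(R)⟩` and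
  `r` in a set `Rset` of representatives, then every `g ∈ P_Δ` is `(∏ qᵢ²) · q` with `qᵢ ∈ P_Δ` and `q ∈ P_Δ` the LEVI
  REPRESENTATIVE of some `r ∈ Rset`: `2 q = C · diag(r, τ⁻¹ σ(r⁻¹)ᵀ τ) · C`, `C = [[1,1],[1,−1]]` the Cayley matrix, `τ = S + S`
  (the conjugate `C m(r) C⁻¹` of the Levi element `m(r)` of `UnitaryGroupDoubledSiegelLevi`; for `r` `σ`-fixed and `S`-orthogonal,
  `rᵀ S r = S`, this is the block-diagonal doubled element `diag(r, r)`, `two_smul_eq_of_orthogonal`).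
  Proof: in the Cayley basis `h = C⁻¹ g C = m(α) n(y)` (`UnitaryGroupDoubledSiegelSquares`); write `α = s r` with `s` a product of
  squares; `m(r) n(y) = n(y') m(r)` with `y' = r y (τ⁻¹σ(r)ᵀτ)` (the Levi normalises the unipotent radical), `n(y') = n(y'/2)²`,
  so `h = (∏ m(sᵢ)²) · n(y'/2)² · m(r)`; conjugate back by `C`.

Use: the archimedean places of type (ii) (a real place of `F` split in `E`) of the general-`E/F` kernel construction of
[GelbartRogawski1991, Prop. 3.1.1]: there `P_Δ(F_v) ≅ P_{n,n}(ℝ)` has four components, two multiplicative scalars on `P_Δ` with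
equal squares agree on the squares and must be compared separately on the Levi representatives
(`GeneralLinearGroup.eq_of_sq_eq_of_prod_squares_mul_rep`).  Nothing in this file depends on that application.

## References

* S. S. Kudla, *Splitting metaplectic covers of dual reductive pairs*, Israel J. Math. 87 (1994), §3 [Kudla1994].
* M. Harris, S. S. Kudla, W. J. Sweet, *Theta dichotomy for unitary groups*, J. Amer. Math. Soc. 9 (1996), §1 (1.9)–(1.12)
  [HarrisKudlaSweet1996].
-/

set_option autoImplicit false

open Matrix

namespace Literature.NumberTheory.Automorphic.DoubledUnitary

variable {R : Type*} [CommRing R] {ι : Type*} [Fintype ι] [DecidableEq ι] (σ : R →+* R)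

/-! ### lists of squares (membership form) -/

/-- an element of the subgroup generated by the squares is a product of squares, as a list. [folklore] -/
private theorem exists_list_of_mem_closure_isSquare {G : Type*} [Group G] {x : G}
    (hx : x ∈ Subgroup.closure {g : G | IsSquare g}) : ∃ l : List G, x = (l.map fun q => q * q).prod := by
  induction hx using Subgroup.closure_induction with
  | mem x hx =>
    obtain ⟨r, rfl⟩ := hx
    exact ⟨[r], by simp⟩
  | one => exact ⟨[], by simp⟩
  | mul x y _ _ ihx ihy =>
    obtain ⟨l₁, rfl⟩ := ihx
    obtain ⟨l₂, rfl⟩ := ihy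
    exact ⟨l₁ ++ l₂, by rw [List.map_append, List.prod_append]⟩
  | inv x _ ih =>
    obtain ⟨l, rfl⟩ := ih
    refine ⟨(l.map fun q => q⁻¹).reverse, ?_⟩
    rw [List.prod_inv_reverse, List.map_map, List.map_reverse, List.map_map]
    exact congrArg (fun l : List G => l.reverse.prod) (List.map_congr_left fun q _ =>
      show (q * q)⁻¹ = q⁻¹ * q⁻¹ from _root_.mul_inv_rev q q)

/-- squares of images along a homomorphism: `((l.map f).map sq).prod = f ((l.map sq).prod)`. [folklore] -/
private theorem map_prod_map_sq' {G H : Type*} [Monoid G] [Monoid H] (f : G →* H) (l : List G) :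
    ((l.map f).map fun q => q * q).prod = f (l.map fun q => q * q).prod := by
  rw [map_list_prod, List.map_map, List.map_map]
  exact congrArg List.prod (List.map_congr_left fun q _ => by simp only [Function.comp_apply, map_mul])

/-! ### the core theorem in the block enumeration `ι ⊕ ι`, with Levi representatives -/

/-- **Every element of the Siegel parabolic `P_Δ` of `U(σ, S ⊕ −S)` is a product of squares of elements of `P_Δ` times the
Levi representative of a coset of `⟨squares⟩` in `GL_ι(R)`.**  For `σ` an involution of the commutative ring `R` with `2 ∈ Rˣ`,
`S` symmetric `σ`-fixed with unit determinant, a set `Rset ⊆ GL_ι(R)` with `GL_ι(R) = ⟨squares⟩ · Rset`, and `g ∈ U(σ, S ⊕ −S)`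
with `g₁₁ + g₁₂ = g₂₁ + g₂₂`: `g = (∏ qᵢ²) · q` with all `qᵢ ∈ P_Δ`, `q ∈ P_Δ`, and `2 q = C · diag(r, τ⁻¹σ(r⁻¹)ᵀτ) · C` for some
`r ∈ Rset` (`C = [[1,1],[1,−1]]`, `τ = S + S`). [cite: HarrisKudlaSweet1996, §1 (1.11)] -/
theorem exists_list_sq_mul_levi_of_isSiegel_blocks (hσ : ∀ x, σ (σ x) = x) (h2 : IsUnit (2 : R))
    {S : Matrix ι ι R} (hSσ : S.map σ = S) (hSs : Sᵀ = S) (hSu : IsUnit S.det)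
    {Rset : Set (GL ι R)}
    (hGL : ∀ A : GL ι R, ∃ u ∈ Subgroup.closure {A : GL ι R | IsSquare A}, ∃ r ∈ Rset, A = u * r)
    {g : GL (ι ⊕ ι) R} (hgU : g ∈ unitaryGroupOfForm σ (Matrix.fromBlocks S 0 0 (-S)))
    (hgP : (g : Matrix (ι ⊕ ι) (ι ⊕ ι) R).toBlocks₁₁ + (g : Matrix (ι ⊕ ι) (ι ⊕ ι) R).toBlocks₁₂ =
      (g : Matrix (ι ⊕ ι) (ι ⊕ ι) R).toBlocks₂₁ + (g : Matrix (ι ⊕ ι) (ι ⊕ ι) R).toBlocks₂₂) :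
    ∃ (l : List (GL (ι ⊕ ι) R)) (r : GL ι R) (q : GL (ι ⊕ ι) R),
      (∀ q' ∈ l, q' ∈ unitaryGroupOfForm σ (Matrix.fromBlocks S 0 0 (-S)) ∧
        (q' : Matrix (ι ⊕ ι) (ι ⊕ ι) R).toBlocks₁₁ + (q' : Matrix (ι ⊕ ι) (ι ⊕ ι) R).toBlocks₁₂ =
          (q' : Matrix (ι ⊕ ι) (ι ⊕ ι) R).toBlocks₂₁ + (q' : Matrix (ι ⊕ ι) (ι ⊕ ι) R).toBlocks₂₂) ∧
      r ∈ Rset ∧ q ∈ unitaryGroupOfForm σ (Matrix.fromBlocks S 0 0 (-S)) ∧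
      (q : Matrix (ι ⊕ ι) (ι ⊕ ι) R).toBlocks₁₁ + (q : Matrix (ι ⊕ ι) (ι ⊕ ι) R).toBlocks₁₂ =
        (q : Matrix (ι ⊕ ι) (ι ⊕ ι) R).toBlocks₂₁ + (q : Matrix (ι ⊕ ι) (ι ⊕ ι) R).toBlocks₂₂ ∧
      (2 : R) • (q : Matrix (ι ⊕ ι) (ι ⊕ ι) R) =
        Matrix.fromBlocks (1 : Matrix ι ι R) (1 : Matrix ι ι R) (1 : Matrix ι ι R) (-1 : Matrix ι ι R) *
          Matrix.fromBlocks (r : Matrix ι ι R) 0 0 ((S + S)⁻¹ * (((r⁻¹ : GL ι R) : Matrix ι ι R).map σ)ᵀ * (S + S)) *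
          Matrix.fromBlocks (1 : Matrix ι ι R) (1 : Matrix ι ι R) (1 : Matrix ι ι R) (-1 : Matrix ι ι R) ∧
      g = (l.map fun q' => q' * q').prod * q := by
  classical
  -- `u = 1/2`, fixed by `σ`
  obtain ⟨u, hu⟩ := h2.exists_left_inv
  have hu' : 2 * u = 1 := by rw [mul_comm]; exact hu
  have hσu : σ u = u := by
    have h1 : σ u * 2 = 1 := by
      have := congrArg σ hu
      rwa [map_mul, map_ofNat, map_one] at this
    calc σ u = σ u * (2 * u) := by rw [hu', mul_one]
      _ = u := by rw [← mul_assoc, h1, one_mul]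
  -- the Cayley unit
  set C : Matrix (ι ⊕ ι) (ι ⊕ ι) R :=
    Matrix.fromBlocks (1 : Matrix ι ι R) (1 : Matrix ι ι R) (1 : Matrix ι ι R) (-1 : Matrix ι ι R) with hC
  have hCC : C * C = (2 : R) • (1 : Matrix (ι ⊕ ι) (ι ⊕ ι) R) := cayleyMat_mul_self
  have hCu1 : C * (u • C) = 1 := by rw [Matrix.mul_smul, hCC, smul_smul, hu, one_smul]
  have hCu2 : u • C * C = 1 := by rw [Matrix.smul_mul, hCC, smul_smul, hu, one_smul]
  set Cu : GL (ι ⊕ ι) R := ⟨C, u • C, hCu1, hCu2⟩ with hCudef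
  -- `τ = 2S` and the antidiagonal form
  set τ : Matrix ι ι R := S + S with hτ
  have hτ2 : τ = (2 : R) • S := by rw [hτ, two_smul]
  have hτσ : τ.map σ = τ := by rw [hτ, Matrix.map_add (⇑σ) (map_add σ), hSσ]
  have hτs : τᵀ = τ := by rw [hτ, Matrix.transpose_add, hSs]
  have hτu : IsUnit τ.det := by
    rw [hτ2, Matrix.det_smul]
    exact (h2.pow _).mul hSu
  have hform : formCongr σ Cu (Matrix.fromBlocks S 0 0 (-S)) = Matrix.fromBlocks 0 τ τ 0 := formCongr_cayleyMat σ S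
  -- `h = C⁻¹ g C ∈ U(σ, antidiag(τ, τ))`
  have hhU : Cu⁻¹ * g * Cu ∈ unitaryGroupOfForm σ (Matrix.fromBlocks 0 τ τ 0) := by
    rw [← hform, ← conj_mem_unitaryGroupOfForm_iff σ Cu]
    simpa only [mul_assoc, mul_inv_cancel, mul_one, mul_inv_cancel_left] using hgU
  -- the blocks of `h`
  set a := (g : Matrix (ι ⊕ ι) (ι ⊕ ι) R).toBlocks₁₁ with ha
  set b := (g : Matrix (ι ⊕ ι) (ι ⊕ ι) R).toBlocks₁₂ with hb
  set c := (g : Matrix (ι ⊕ ι) (ι ⊕ ι) R).toBlocks₂₁ with hc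
  set d := (g : Matrix (ι ⊕ ι) (ι ⊕ ι) R).toBlocks₂₂ with hd
  have hgabcd : (g : Matrix (ι ⊕ ι) (ι ⊕ ι) R) = Matrix.fromBlocks a b c d := (Matrix.fromBlocks_toBlocks _).symm
  set α : Matrix ι ι R := u • (a + c + (b + d)) with hα
  set β : Matrix ι ι R := u • (a + c - (b + d)) with hβ
  set δ : Matrix ι ι R := u • (a - c - (b - d)) with hδ
  have hhmat : ((Cu⁻¹ * g * Cu : GL (ι ⊕ ι) R) : Matrix (ι ⊕ ι) (ι ⊕ ι) R) = Matrix.fromBlocks α β 0 δ := by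
    change u • C * (g : Matrix (ι ⊕ ι) (ι ⊕ ι) R) * C = _
    rw [Matrix.smul_mul, Matrix.smul_mul, hgabcd, hC, cayleyMat_mul_mul_cayleyMat, Matrix.fromBlocks_smul]
    have hzero : a - c + (b - d) = 0 := by
      rw [show a - c + (b - d) = (a + b) - (c + d) by abel, hgP, sub_self]
    rw [hzero, smul_zero]
  -- `α` is invertible
  have hαu : IsUnit α.det := by
    have hdet : IsUnit ((Cu⁻¹ * g * Cu : GL (ι ⊕ ι) R) : Matrix (ι ⊕ ι) (ι ⊕ ι) R).det :=
      ⟨Matrix.GeneralLinearGroup.det (Cu⁻¹ * g * Cu), rfl⟩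
    rw [hhmat, Matrix.det_fromBlocks_zero₂₁] at hdet
    exact isUnit_of_mul_isUnit_left hdet
  obtain ⟨αU, hαU⟩ := (Matrix.isUnit_iff_isUnit_det α).2 hαu
  -- the Levi homomorphism and the unipotent elements
  obtain ⟨m, hm, hmU⟩ := exists_leviHom σ hσ hτσ hτs hτu
  obtain ⟨nn, hnn, hnn_add, hnnU⟩ := exists_unipotent σ τ
  -- the relation `σ(α)ᵀ τ δ = τ` from `h ∈ U₁`
  have hrel : (α.map σ)ᵀ * τ * δ = τ := by
    have key := hhU
    rw [mem_unitaryGroupOfForm_iff, hhmat, Matrix.fromBlocks_map, Matrix.map_zero σ (map_zero σ),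
      Matrix.fromBlocks_transpose, Matrix.transpose_zero] at key
    simp only [Matrix.fromBlocks_multiply, Matrix.zero_mul, Matrix.mul_zero, add_zero, zero_add] at key
    exact (Matrix.fromBlocks_inj.1 key).2.1
  -- hence `δ = τ⁻¹ σ(α⁻¹)ᵀ τ`
  have hααinv : (α : Matrix ι ι R) * ((αU⁻¹ : GL ι R) : Matrix ι ι R) = 1 := by
    rw [← hαU, ← Units.val_mul, mul_inv_cancel, Units.val_one]
  have hδeq : δ = τ⁻¹ * (((αU⁻¹ : GL ι R) : Matrix ι ι R).map σ)ᵀ * τ := by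
    have h1 : (((αU⁻¹ : GL ι R) : Matrix ι ι R).map σ)ᵀ * (α.map σ)ᵀ = 1 := by
      rw [← Matrix.transpose_mul, ← Matrix.map_mul, hααinv, Matrix.map_one σ (map_zero σ) (map_one σ),
        Matrix.transpose_one]
    calc δ = τ⁻¹ * ((((αU⁻¹ : GL ι R) : Matrix ι ι R).map σ)ᵀ * (α.map σ)ᵀ) * τ * δ := by
          rw [h1, Matrix.mul_one, Matrix.nonsing_inv_mul τ hτu, Matrix.one_mul]
      _ = τ⁻¹ * (((αU⁻¹ : GL ι R) : Matrix ι ι R).map σ)ᵀ * ((α.map σ)ᵀ * τ * δ) := by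
          simp only [Matrix.mul_assoc]
      _ = τ⁻¹ * (((αU⁻¹ : GL ι R) : Matrix ι ι R).map σ)ᵀ * τ := by rw [hrel]
  -- the factorisation `h = m(α) n(y)`, `y = α⁻¹ β`
  set y : Matrix ι ι R := ((αU⁻¹ : GL ι R) : Matrix ι ι R) * β with hy
  have hfac : Cu⁻¹ * g * Cu = m αU * nn y := by
    refine Units.ext ?_
    rw [hhmat, Units.val_mul, hm, hnn, hαU, Matrix.fromBlocks_multiply]
    simp only [Matrix.mul_one, Matrix.mul_zero, Matrix.zero_mul, add_zero, zero_add]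
    rw [hy, ← Matrix.mul_assoc, hααinv, Matrix.one_mul, ← hδeq]
  -- `α = s r`, `s` a product of squares, `r ∈ Rset`
  obtain ⟨s, hs, r, hr, hαsr⟩ := hGL αU
  obtain ⟨lα, hlα⟩ := exists_list_of_mem_closure_isSquare hs
  -- the Levi normalises the unipotent radical: `m(r) n(y) = n(y₂) m(r)` with `y₂ = r y (τ⁻¹ σ(r)ᵀ τ)`
  set y₂ : Matrix ι ι R := (r : Matrix ι ι R) * y * (τ⁻¹ * ((r : Matrix ι ι R).map σ)ᵀ * τ) with hy₂
  have hrrinv : (((r⁻¹ : GL ι R) : Matrix ι ι R).map σ) * ((r : Matrix ι ι R).map σ) = 1 := by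
    rw [← Matrix.map_mul, ← Units.val_mul, inv_mul_cancel, Units.val_one, Matrix.map_one σ (map_zero σ) (map_one σ)]
  have hy₂r : y₂ * (τ⁻¹ * (((r⁻¹ : GL ι R) : Matrix ι ι R).map σ)ᵀ * τ) = (r : Matrix ι ι R) * y := by
    rw [hy₂]
    calc (r : Matrix ι ι R) * y * (τ⁻¹ * ((r : Matrix ι ι R).map σ)ᵀ * τ) *
          (τ⁻¹ * (((r⁻¹ : GL ι R) : Matrix ι ι R).map σ)ᵀ * τ)
        = (r : Matrix ι ι R) * y * (τ⁻¹ * (((r : Matrix ι ι R).map σ)ᵀ * ((τ * τ⁻¹) *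
            (((r⁻¹ : GL ι R) : Matrix ι ι R).map σ)ᵀ)) * τ) := by simp only [Matrix.mul_assoc]
      _ = (r : Matrix ι ι R) * y := by
          rw [Matrix.mul_nonsing_inv τ hτu, Matrix.one_mul, ← Matrix.transpose_mul, hrrinv, Matrix.transpose_one,
            Matrix.mul_one, Matrix.nonsing_inv_mul τ hτu, Matrix.mul_one]
  have hcomm : m r * nn y = nn y₂ * m r := by
    refine Units.ext ?_
    rw [Units.val_mul, Units.val_mul, hm, hnn, hnn, Matrix.fromBlocks_multiply, Matrix.fromBlocks_multiply]
    simp only [Matrix.mul_one, Matrix.one_mul, Matrix.mul_zero, Matrix.zero_mul, add_zero, zero_add]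
    rw [hy₂r]
  have hfac' : Cu⁻¹ * g * Cu = m s * nn y₂ * m r := by
    rw [hfac, hαsr, map_mul, mul_assoc, hcomm, ← mul_assoc]
  -- `n(y₂) ∈ U₁`, hence the criterion, hence `n(y₂) = n(y₂/2)²` inside `U₁`
  have hny₂U : nn y₂ ∈ unitaryGroupOfForm σ (Matrix.fromBlocks 0 τ τ 0) := by
    have : nn y₂ = (m s)⁻¹ * (Cu⁻¹ * g * Cu) * (m r)⁻¹ := by
      rw [hfac', mul_assoc, mul_assoc, mul_inv_cancel, mul_one, inv_mul_cancel_left]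
    rw [this]
    exact mul_mem (mul_mem (inv_mem (hmU s)) hhU) (inv_mem (hmU r))
  have hycrit : τ * y₂ + (y₂.map σ)ᵀ * τ = 0 := (hnnU y₂).1 hny₂U
  set z : Matrix ι ι R := u • y₂ with hz
  have hzσ : z.map σ = u • y₂.map σ := by
    ext i j
    simp only [hz, Matrix.map_apply, Matrix.smul_apply, smul_eq_mul, map_mul, hσu]
  have hzcrit : τ * z + (z.map σ)ᵀ * τ = 0 := by
    rw [hzσ, Matrix.transpose_smul, Matrix.smul_mul, hz, Matrix.mul_smul, ← smul_add, hycrit, smul_zero]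
  have hnzU : nn z ∈ unitaryGroupOfForm σ (Matrix.fromBlocks 0 τ τ 0) := (hnnU z).2 hzcrit
  have hzz : z + z = y₂ := by rw [hz, ← add_smul, ← mul_two, hu, one_smul]
  have hnnz : nn z * nn z = nn y₂ := by rw [← hnn_add, hzz]
  -- the list in the Cayley model: `h = (∏ m(sᵢ)²) · n(z)² · m(r)`
  set L : List (GL (ι ⊕ ι) R) := lα.map m ++ [nn z] with hL
  have hLprod : (L.map fun q => q * q).prod * m r = Cu⁻¹ * g * Cu := by
    rw [hL, List.map_append, List.prod_append, map_prod_map_sq' m lα, ← hlα, List.map_singleton,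
      List.prod_singleton, hnnz, hfac']
  have hLmem : ∀ q ∈ L ++ [m r], q ∈ unitaryGroupOfForm σ (Matrix.fromBlocks 0 τ τ 0) ∧
      (q : Matrix (ι ⊕ ι) (ι ⊕ ι) R).toBlocks₂₁ = 0 := by
    intro q hq
    rw [hL, List.append_assoc, List.singleton_append, List.mem_append, List.mem_map, List.mem_cons,
      List.mem_singleton] at hq
    rcases hq with ⟨s', -, rfl⟩ | rfl | rfl
    · exact ⟨hmU s', by rw [hm, Matrix.toBlocks_fromBlocks₂₁]⟩
    · exact ⟨hnzU, by rw [hnn, Matrix.toBlocks_fromBlocks₂₁]⟩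
    · exact ⟨hmU r, by rw [hm, Matrix.toBlocks_fromBlocks₂₁]⟩
  -- conjugating a block-upper element of `U₁` back by `C` lands in `P_Δ ⊆ U(σ, S ⊕ −S)`
  have hback : ∀ q : GL (ι ⊕ ι) R, q ∈ unitaryGroupOfForm σ (Matrix.fromBlocks 0 τ τ 0) →
      (q : Matrix (ι ⊕ ι) (ι ⊕ ι) R).toBlocks₂₁ = 0 →
      Cu * q * Cu⁻¹ ∈ unitaryGroupOfForm σ (Matrix.fromBlocks S 0 0 (-S)) ∧
        ((Cu * q * Cu⁻¹ : GL (ι ⊕ ι) R) : Matrix (ι ⊕ ι) (ι ⊕ ι) R).toBlocks₁₁ +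
            ((Cu * q * Cu⁻¹ : GL (ι ⊕ ι) R) : Matrix (ι ⊕ ι) (ι ⊕ ι) R).toBlocks₁₂ =
          ((Cu * q * Cu⁻¹ : GL (ι ⊕ ι) R) : Matrix (ι ⊕ ι) (ι ⊕ ι) R).toBlocks₂₁ +
            ((Cu * q * Cu⁻¹ : GL (ι ⊕ ι) R) : Matrix (ι ⊕ ι) (ι ⊕ ι) R).toBlocks₂₂ := by
    intro q hqU hq21
    refine ⟨?_, ?_⟩
    · rw [conj_mem_unitaryGroupOfForm_iff σ Cu, hform]
      exact hqU
    · have hqmat : (q : Matrix (ι ⊕ ι) (ι ⊕ ι) R) =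
          Matrix.fromBlocks (q : Matrix (ι ⊕ ι) (ι ⊕ ι) R).toBlocks₁₁ (q : Matrix (ι ⊕ ι) (ι ⊕ ι) R).toBlocks₁₂ 0
            (q : Matrix (ι ⊕ ι) (ι ⊕ ι) R).toBlocks₂₂ := by
        conv_lhs => rw [← Matrix.fromBlocks_toBlocks (q : Matrix (ι ⊕ ι) (ι ⊕ ι) R), hq21]
      have hconj : ((Cu * q * Cu⁻¹ : GL (ι ⊕ ι) R) : Matrix (ι ⊕ ι) (ι ⊕ ι) R) =
          u • Matrix.fromBlocks
            ((q : Matrix (ι ⊕ ι) (ι ⊕ ι) R).toBlocks₁₁ + 0 +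
              ((q : Matrix (ι ⊕ ι) (ι ⊕ ι) R).toBlocks₁₂ + (q : Matrix (ι ⊕ ι) (ι ⊕ ι) R).toBlocks₂₂))
            ((q : Matrix (ι ⊕ ι) (ι ⊕ ι) R).toBlocks₁₁ + 0 -
              ((q : Matrix (ι ⊕ ι) (ι ⊕ ι) R).toBlocks₁₂ + (q : Matrix (ι ⊕ ι) (ι ⊕ ι) R).toBlocks₂₂))
            ((q : Matrix (ι ⊕ ι) (ι ⊕ ι) R).toBlocks₁₁ - 0 +
              ((q : Matrix (ι ⊕ ι) (ι ⊕ ι) R).toBlocks₁₂ - (q : Matrix (ι ⊕ ι) (ι ⊕ ι) R).toBlocks₂₂))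
            ((q : Matrix (ι ⊕ ι) (ι ⊕ ι) R).toBlocks₁₁ - 0 -
              ((q : Matrix (ι ⊕ ι) (ι ⊕ ι) R).toBlocks₁₂ - (q : Matrix (ι ⊕ ι) (ι ⊕ ι) R).toBlocks₂₂)) := by
        change C * (q : Matrix (ι ⊕ ι) (ι ⊕ ι) R) * (u • C) = _
        rw [Matrix.mul_smul]
        conv_lhs => rw [hqmat, hC, cayleyMat_mul_mul_cayleyMat]
      rw [hconj, Matrix.fromBlocks_smul, Matrix.toBlocks_fromBlocks₁₁, Matrix.toBlocks_fromBlocks₁₂,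
        Matrix.toBlocks_fromBlocks₂₁, Matrix.toBlocks_fromBlocks₂₂, ← smul_add, ← smul_add]
      congr 1
      abel
  -- the representative `q = C m(r) C⁻¹`
  refine ⟨L.map fun q => Cu * q * Cu⁻¹, r, Cu * m r * Cu⁻¹, fun q' hq' => ?_, hr,
    (hback (m r) (hmU r) (by rw [hm, Matrix.toBlocks_fromBlocks₂₁])).1,
    (hback (m r) (hmU r) (by rw [hm, Matrix.toBlocks_fromBlocks₂₁])).2, ?_, ?_⟩
  · rw [List.mem_map] at hq'
    obtain ⟨q, hq, rfl⟩ := hq'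
    obtain ⟨hqU, hq21⟩ := hLmem q (List.mem_append_left _ hq)
    exact hback q hqU hq21
  · -- `2 • (C m(r) (u C)) = C m(r) C`
    change (2 : R) • (C * ((m r : GL (ι ⊕ ι) R) : Matrix (ι ⊕ ι) (ι ⊕ ι) R) * (u • C)) = _
    rw [Matrix.mul_smul, smul_smul, hu', one_smul, hm]
  · -- the product
    have hφ : (L.map fun q => Cu * q * Cu⁻¹) = L.map (MulAut.conj Cu).toMonoidHom := by
      refine List.map_congr_left fun q _ => ?_
      rfl
    rw [hφ, map_prod_map_sq']
    change g = Cu * (L.map fun q => q * q).prod * Cu⁻¹ * (Cu * m r * Cu⁻¹)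
    have h1 : Cu * (L.map fun q => q * q).prod * Cu⁻¹ * (Cu * m r * Cu⁻¹) =
        Cu * ((L.map fun q => q * q).prod * m r) * Cu⁻¹ := by group
    rw [h1, hLprod]
    group

/-- **For an `S`-orthogonal `σ`-fixed representative the Levi representative is the doubled element `diag(r, r)`**: if
`σ(r) = r` and `rᵀ S r = S` then `C · diag(r, τ⁻¹σ(r⁻¹)ᵀτ) · C = 2 · diag(r, r)` (`τ = S + S`).  E.g. `r` a diagonal sign
matrix and `S` diagonal. [cite: HarrisKudlaSweet1996, §1 (1.11)] -/
theorem cayley_levi_cayley_eq_two_smul_of_orthogonal (h2 : IsUnit (2 : R)) {S : Matrix ι ι R} (hSu : IsUnit S.det)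
    (r : GL ι R) (hrσ : (r : Matrix ι ι R).map σ = r) (hrS : (r : Matrix ι ι R)ᵀ * S * r = S) :
    Matrix.fromBlocks (1 : Matrix ι ι R) (1 : Matrix ι ι R) (1 : Matrix ι ι R) (-1 : Matrix ι ι R) *
        Matrix.fromBlocks (r : Matrix ι ι R) 0 0 ((S + S)⁻¹ * (((r⁻¹ : GL ι R) : Matrix ι ι R).map σ)ᵀ * (S + S)) *
        Matrix.fromBlocks (1 : Matrix ι ι R) (1 : Matrix ι ι R) (1 : Matrix ι ι R) (-1 : Matrix ι ι R) =
      (2 : R) • Matrix.fromBlocks (r : Matrix ι ι R) 0 0 r := by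
  -- `τ = 2S`, `rᵀ τ r = τ`, so `τ⁻¹ (r⁻¹)ᵀ τ = r`
  set τ : Matrix ι ι R := S + S with hτ
  have hτ2 : τ = (2 : R) • S := by rw [hτ, two_smul]
  have hτu : IsUnit τ.det := by
    rw [hτ2, Matrix.det_smul]
    exact (h2.pow _).mul hSu
  have hrτ : (r : Matrix ι ι R)ᵀ * τ * r = τ := by
    rw [hτ2, Matrix.mul_smul, Matrix.smul_mul, hrS]
  have hrinvσ : ((r⁻¹ : GL ι R) : Matrix ι ι R).map σ = ((r⁻¹ : GL ι R) : Matrix ι ι R) := by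
    -- `σ(r⁻¹) = σ(r)⁻¹ = r⁻¹` (uniqueness of the inverse)
    have h1 : (((r⁻¹ : GL ι R) : Matrix ι ι R).map σ) * (r : Matrix ι ι R) = 1 := by
      conv_lhs => rw [← hrσ]
      rw [← Matrix.map_mul, ← Units.val_mul, inv_mul_cancel, Units.val_one, Matrix.map_one σ (map_zero σ) (map_one σ)]
    have h2' : ((r⁻¹ : GL ι R) : Matrix ι ι R) * (r : Matrix ι ι R) = 1 := by
      rw [← Units.val_mul, inv_mul_cancel, Units.val_one]
    calc (((r⁻¹ : GL ι R) : Matrix ι ι R).map σ)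
        = (((r⁻¹ : GL ι R) : Matrix ι ι R).map σ) * ((r : Matrix ι ι R) * ((r⁻¹ : GL ι R) : Matrix ι ι R)) := by
          rw [← Units.val_mul, mul_inv_cancel, Units.val_one, Matrix.mul_one]
      _ = ((r⁻¹ : GL ι R) : Matrix ι ι R) := by rw [← Matrix.mul_assoc, h1, Matrix.one_mul]
  have hblock : τ⁻¹ * (((r⁻¹ : GL ι R) : Matrix ι ι R).map σ)ᵀ * τ = r := by
    rw [hrinvσ]
    -- from `rᵀ τ r = τ`: `(r⁻¹)ᵀ τ = τ r`... precisely `(r⁻¹)ᵀ = τ r τ⁻¹`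
    have h3 : ((r⁻¹ : GL ι R) : Matrix ι ι R)ᵀ * ((r : Matrix ι ι R)ᵀ * τ * r) = τ * r := by
      rw [← Matrix.mul_assoc, ← Matrix.mul_assoc, ← Matrix.transpose_mul, ← Units.val_mul, mul_inv_cancel, Units.val_one,
        Matrix.transpose_one, Matrix.one_mul]
    rw [hrτ] at h3
    calc τ⁻¹ * ((r⁻¹ : GL ι R) : Matrix ι ι R)ᵀ * τ = τ⁻¹ * (((r⁻¹ : GL ι R) : Matrix ι ι R)ᵀ * τ) := by
          rw [Matrix.mul_assoc]
      _ = τ⁻¹ * (τ * r) := by rw [h3]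
      _ = r := by rw [← Matrix.mul_assoc, Matrix.nonsing_inv_mul τ hτu, Matrix.one_mul]
  rw [hblock, cayleyMat_mul_mul_cayleyMat, Matrix.fromBlocks_smul, smul_zero, two_smul]
  congr 1 <;> abel

end Literature.NumberTheory.Automorphic.DoubledUnitary
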